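import Summits.QuantumFields.YangMills.Theorems.UnitScaleTiltProp7MlogSecondDerivative
import Summits.QuantumFields.YangMills.Theorems.UnitScaleTiltProp7QSymGaugeCovariance
import HarnessLib

/-!
# (q-gauge) SUPPLIER, S1-SPEC (2) — F2: **THE CHART CURVE OF THE GAUGE COPIES THROUGH A CHART POINT `A₀`**, its velocity `V(A₀)`, `V(0) = D_{U₀}N`, and
# `d∕ds|₀ V(sY) = ½[N + Ad_{U₀}N′, Y]` — the letters (ii)–(iii) of ✓`Prop7ChartGaugeCovarianceDeriv.fderiv_logChartTwS_gaugeVelocity_apply` INHABITED at every small chart point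

Cell `ym3-torus` (HUMAN RULING D-0037, YM ladder rung R3 — SU(2) YM₃ on T³: NOT d = 4, NOT infinite volume, NOT a mass gap, NOT Clay).  Width seat `ym3-torus-px19` (gen 15); chart side of the
pointwise second-order gauge-covariance identity (2) (S1-SPEC (2), `h2` of ✓`Prop7AvgHessGaugeIdentityNormReading`).  THEOREMS ONLY (0 `def`, 0 `sorry`, default heartbeats);
`--supports stmt-QuantumFields-19200 --as helper`; count-neutral; NO claim on crux ∕ stub ∕ registry.

THE MATHEMATICS.  At the chart point `A₀` (field `e^{A₀}U₀`) the gauge copies by `g_t = e^{tN}` have chart coordinates `A_t(b) = log(e^{tN(b₋)}·e^{A₀(b)}U₀(b)·e^{−tN(b₊)}·U₀(b)⁻¹)` for small `t`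
(`exp ∘ log = id` on `‖· − 1‖ < 1`; ✓`Prop7QSymGaugeCovariance.expUnit_chartCurve_eventually` is the case `A₀ = 0`).  Its velocity is
`V(A₀)(b) = Dlog(e^{A₀(b)})[N(b₋)e^{A₀(b)} − e^{A₀(b)}·U₀(b)N(b₊)U₀(b)⁻¹]`; at `A₀ = 0`, `V(0) = D_{U₀}N = N(b₋) − U₀(b)N(b₊)U₀(b)⁻¹` (`Dlog(1) = 1`); and along `A₀ = sY`,
`d∕ds|₀ V(sY)(b) = D²log(1)[Y(b), N(b₋) − M] + (N(b₋)Y(b) − Y(b)M) = ½[(N(b₋) + M), Y(b)]`, `M = U₀(b)N(b₊)U₀(b)⁻¹` (F1 ✓`Prop7MlogSecondDerivative.hasDerivAt_fderiv_mlog_comp_apply`) — the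
first-order commutator of the chart pull-back of the gauge velocity, `V_A = (N − AdN′) + ½[N + AdN′, A] + O(A²)`, WITHOUT the BCH series.

WHAT IS PROVED (generic complete normed `ℂ`-algebra `𝔸` for the bond letters; then the T³ member; namespace `…Theorems.Prop7ChartGaugeCurveAt`).
* §1 (one bond, `M : 𝔸ˣ` the background bond variable) `norm_exp_sub_one_lt_one_of_lt_log_two`, `conjCurveAt_zero`, ★`hasDerivAt_mlog_conjCurveAt` (velocity at a chart point, complex `t`),
  `mlog_conjCurveAt_zero` (`A_0 = A₀`), `eventually_norm_conjCurveAt_sub_one_lt`, `velocityAt_zero` (`V(0) = X − MYM⁻¹`), ★★`hasDerivAt_velocityAt_smul`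
  (`d∕ds|₀ V(sY₀) = 2⁻¹•((X + MYM⁻¹)Y₀ − Y₀(X + MYM⁻¹))`).
* §2 (member `F`, background `U₀`, chart point `A₀` with `‖A₀ b‖ < log 2`) ★`hasDerivAt_chartCurveAt` (complex) ∕ ★`hasDerivAt_chartCurveAt_real`, `chartCurveAt_zero`, ★`expUnit_chartCurveAt_eventually`
  (complex) ∕ ★`expUnit_chartCurveAt_eventually_real` — the `hcopy` letter at `A₀`, `gaugeVelocityAt_zero` (`V(0) = D_{U₀}N`), ★★★`hasDerivAt_gaugeVelocityAt_smul`
  (`HasDerivAt (s ↦ V(s•Y)) (2⁻¹•comm) 0`, `comm b = (N b₋ + U₀N b₊U₀⁻¹)·Y b − Y b·(N b₋ + U₀N b₊U₀⁻¹)`), and the real gauge family letters `gaugeFamily_zero`, `hasDerivAt_gaugeFamily`.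
HONEST SCOPE.  Chart bookkeeping; nothing of (2), FR₂-lite, `hqG`, norm_G, EX, the crux or rung R3 is proved here; the Yang–Mills mass gap is NOT proved.

References: T. Bałaban, CMP **98** (1985) 17–51 [Balaban1985Averaging] ((8) p.19, (11) p.19, (21) p.21, p.28); CMP **99** (1985) 389–434 [Balaban1985BackgroundPropagators] ((3.19) p.393,
(3.114)–(3.115) p.418).
-/

set_option autoImplicit false

noncomputable section

open scoped Topology Matrix.Norms.L2Operator
open Filter NormedSpace

namespace Summit.QuantumFields.YangMills.Theorems.Prop7ChartGaugeCurveAt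

open Literature.MathematicalPhysics.QuantumFieldTheory.Balaban1983to89
open Literature.MathematicalPhysics.QuantumFieldTheory.Balaban1983to89.T3ContinuumYM3Torus
open MatrixLog (mlog mlog_def mlog_one analyticAt_mlog exp_mlog)
open B10Eq27TorusAxialLog (gaugeActT gaugeActT_apply)
open B7Prop1Explicit (expUnit val_expUnit val_inv_expUnit)
open T3SectALandauChart (bgUnits)
open Literature.Analysis.Calculus.BCH (logOnePlus_exp_sub_one)
open Summit.QuantumFields.YangMills.Theorems.Prop7QSymGaugeCovariance (hasDerivAt_conjCurve)
open Summit.QuantumFields.YangMills.Theorems.Prop7MlogSecondDerivative (fderiv_mlog_one hasDerivAt_fderiv_mlog_comp_apply)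

/-! ## §1 One bond: the conjugation curve through a chart point -/

section Bond

variable {𝔸 : Type*} [NormedRing 𝔸] [NormedAlgebra ℂ 𝔸] [CompleteSpace 𝔸]

/-- `‖a‖ < log 2 ⟹ ‖e^{a} − 1‖ < 1` (`‖e^a − 1‖ ≤ e^{‖a‖} − 1`). [folklore] -/
theorem norm_exp_sub_one_lt_one_of_lt_log_two {a : 𝔸} (ha : ‖a‖ < Real.log 2) : ‖exp a - 1‖ < 1 := by
  have h1 := Literature.Analysis.Calculus.norm_exp_sub_one_le a
  have h2 : Real.exp ‖a‖ < 2 := by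
    calc Real.exp ‖a‖ < Real.exp (Real.log 2) := Real.exp_lt_exp.2 ha
      _ = 2 := Real.exp_log two_pos
  linarith

omit [CompleteSpace 𝔸] in
/-- The curve at `t = 0`: `e^{0}·(E·M)·e^{0}·M⁻¹ = E`. [folklore] -/
theorem conjCurveAt_zero (X Y E : 𝔸) (M : 𝔸ˣ) :
    exp ((0 : ℂ) • X) * (E * (M : 𝔸)) * exp ((0 : ℂ) • (-Y)) * ((M⁻¹ : 𝔸ˣ) : 𝔸) = E := by
  rw [zero_smul, zero_smul, exp_zero, one_mul, mul_one, mul_assoc, Units.mul_inv, mul_one]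

/-- ★ **VELOCITY OF THE CHART CURVE AT A CHART POINT**: `d∕dt|₀ log(e^{tX}·e^{a}M·e^{−tY}·M⁻¹) = Dlog(e^{a})[X e^{a} − e^{a}·MYM⁻¹]` (`‖a‖ < log 2`; complex `t`).
[cite: Balaban1985Averaging, (21) p.21, p.28] -/
theorem hasDerivAt_mlog_conjCurveAt (X Y : 𝔸) (M : 𝔸ˣ) {a : 𝔸} (ha : ‖a‖ < Real.log 2) :
    HasDerivAt (fun t : ℂ => mlog (exp (t • X) * (exp a * (M : 𝔸)) * exp (t • (-Y)) * ((M⁻¹ : 𝔸ˣ) : 𝔸)))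
      (fderiv ℂ (mlog : 𝔸 → 𝔸) (exp a) (X * exp a - exp a * ((M : 𝔸) * Y * ((M⁻¹ : 𝔸ˣ) : 𝔸)))) 0 := by
  have hc := hasDerivAt_conjCurve X Y (exp a * (M : 𝔸)) ((M⁻¹ : 𝔸ˣ) : 𝔸)
  have hm : HasFDerivAt (mlog : 𝔸 → 𝔸) (fderiv ℂ (mlog : 𝔸 → 𝔸) (exp a)) (exp ((0 : ℂ) • X) * (exp a * (M : 𝔸)) * exp ((0 : ℂ) • (-Y)) * ((M⁻¹ : 𝔸ˣ) : 𝔸)) := by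
    rw [conjCurveAt_zero]
    exact (analyticAt_mlog (norm_exp_sub_one_lt_one_of_lt_log_two ha)).differentiableAt.hasFDerivAt
  have h := hm.comp_hasDerivAt (0 : ℂ) hc
  have heq : X * (exp a * (M : 𝔸)) * ((M⁻¹ : 𝔸ˣ) : 𝔸) - exp a * (M : 𝔸) * Y * ((M⁻¹ : 𝔸ˣ) : 𝔸) = X * exp a - exp a * ((M : 𝔸) * Y * ((M⁻¹ : 𝔸ˣ) : 𝔸)) := by
    rw [mul_assoc X, mul_assoc (exp a), Units.mul_inv, mul_one]
    noncomm_ring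
  rw [heq] at h
  simpa only [Function.comp_def] using h

/-- The chart curve starts at the chart point: `log(e^{0}·e^{a}M·e^{0}·M⁻¹) = a` (`‖a‖ < log 2`). [cite: Balaban1985Averaging, (21) p.21] -/
theorem mlog_conjCurveAt_zero (X Y : 𝔸) (M : 𝔸ˣ) {a : 𝔸} (ha : ‖a‖ < Real.log 2) :
    mlog (exp ((0 : ℂ) • X) * (exp a * (M : 𝔸)) * exp ((0 : ℂ) • (-Y)) * ((M⁻¹ : 𝔸ˣ) : 𝔸)) = a := by
  rw [conjCurveAt_zero, mlog_def, logOnePlus_exp_sub_one ha]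

/-- The chart curve stays in the `log` window near `t = 0`: `∀ᶠ t, ‖e^{tX}e^{a}Me^{−tY}M⁻¹ − 1‖ < 1` (`‖a‖ < log 2`). [folklore] -/
theorem eventually_norm_conjCurveAt_sub_one_lt (X Y : 𝔸) (M : 𝔸ˣ) {a : 𝔸} (ha : ‖a‖ < Real.log 2) :
    ∀ᶠ t : ℂ in 𝓝 0, ‖exp (t • X) * (exp a * (M : 𝔸)) * exp (t • (-Y)) * ((M⁻¹ : 𝔸ˣ) : 𝔸) - 1‖ < 1 := by
  have hc : ContinuousAt (fun t : ℂ => exp (t • X) * (exp a * (M : 𝔸)) * exp (t • (-Y)) * ((M⁻¹ : 𝔸ˣ) : 𝔸)) 0 :=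
    (hasDerivAt_conjCurve X Y (exp a * (M : 𝔸)) ((M⁻¹ : 𝔸ˣ) : 𝔸)).continuousAt
  have h0 : (fun t : ℂ => exp (t • X) * (exp a * (M : 𝔸)) * exp (t • (-Y)) * ((M⁻¹ : 𝔸ˣ) : 𝔸)) 0 = exp a := conjCurveAt_zero X Y (exp a) M
  have hopen : IsOpen {Z : 𝔸 | ‖Z - 1‖ < 1} := isOpen_lt (continuous_id.sub continuous_const).norm continuous_const
  have hmem : {Z : 𝔸 | ‖Z - 1‖ < 1} ∈ 𝓝 ((fun t : ℂ => exp (t • X) * (exp a * (M : 𝔸)) * exp (t • (-Y)) * ((M⁻¹ : 𝔸ˣ) : 𝔸)) 0) := by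
    rw [h0]; exact hopen.mem_nhds (norm_exp_sub_one_lt_one_of_lt_log_two ha)
  exact hc.eventually_mem hmem

/-- **`V(0) = X − MYM⁻¹`**: at the chart origin (`a = 0`) the velocity is the gauge direction at the background (`Dlog(1) = 1`, `e^0 = 1`). [cite: Balaban1985BackgroundPropagators, (3.19) p.393] -/
theorem velocityAt_zero (X Y : 𝔸) (M : 𝔸ˣ) :
    fderiv ℂ (mlog : 𝔸 → 𝔸) (exp (0 : 𝔸)) (X * exp (0 : 𝔸) - exp (0 : 𝔸) * ((M : 𝔸) * Y * ((M⁻¹ : 𝔸ˣ) : 𝔸))) = X - (M : 𝔸) * Y * ((M⁻¹ : 𝔸ˣ) : 𝔸) := by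
  rw [exp_zero, fderiv_mlog_one, one_apply_eq_self, mul_one, one_mul]

/-- ★★ **`d∕ds|₀ V(sY₀) = ½[(X + MYM⁻¹), Y₀]`**: the `s`-derivative at `0` of the velocity along the chart ray `a = sY₀` — `D²log(1)[Y₀, X − MYM⁻¹] + (XY₀ − Y₀MYM⁻¹)`
(F1 ✓`hasDerivAt_fderiv_mlog_comp_apply` with `γ s = e^{sY₀}`). [cite: Balaban1985Averaging, (21) p.21; Balaban1985BackgroundPropagators, (3.114)–(3.115) p.418] -/
theorem hasDerivAt_velocityAt_smul (X Y : 𝔸) (M : 𝔸ˣ) (Y₀ : 𝔸) :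
    HasDerivAt (fun s : ℂ => fderiv ℂ (mlog : 𝔸 → 𝔸) (exp (s • Y₀)) (X * exp (s • Y₀) - exp (s • Y₀) * ((M : 𝔸) * Y * ((M⁻¹ : 𝔸ˣ) : 𝔸))))
      ((2 : ℂ)⁻¹ • ((X + (M : 𝔸) * Y * ((M⁻¹ : 𝔸ˣ) : 𝔸)) * Y₀ - Y₀ * (X + (M : 𝔸) * Y * ((M⁻¹ : 𝔸ˣ) : 𝔸)))) 0 := by
  have hγ : HasDerivAt (fun s : ℂ => exp (s • Y₀)) Y₀ 0 := by
    simpa using hasDerivAt_exp_smul_const (𝕂 := ℂ) Y₀ (0 : ℂ)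
  have hγ0 : exp ((0 : ℂ) • Y₀) = (1 : 𝔸) := by rw [zero_smul, exp_zero]
  have hw : HasDerivAt (fun s : ℂ => X * exp (s • Y₀) - exp (s • Y₀) * ((M : 𝔸) * Y * ((M⁻¹ : 𝔸ˣ) : 𝔸)))
      (X * Y₀ - Y₀ * ((M : 𝔸) * Y * ((M⁻¹ : 𝔸ˣ) : 𝔸))) 0 :=
    (hγ.const_mul X).sub (hγ.mul_const _)
  have h := hasDerivAt_fderiv_mlog_comp_apply hγ0 hγ hw
  refine h.congr_deriv ?_
  rw [zero_smul, exp_zero, mul_one, one_mul]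
  set P : 𝔸 := (M : 𝔸) * Y * ((M⁻¹ : 𝔸ˣ) : 𝔸)
  have h2 : -((2 : ℂ)⁻¹ • (Y₀ * (X - P) + (X - P) * Y₀)) + (X * Y₀ - Y₀ * P)
      = (2 : ℂ)⁻¹ • (-(Y₀ * (X - P) + (X - P) * Y₀)) + (2 : ℂ)⁻¹ • ((2 : ℂ) • (X * Y₀ - Y₀ * P)) := by
    rw [smul_neg, smul_smul, inv_mul_cancel₀ two_ne_zero, one_smul]
  rw [h2, ← smul_add, two_smul]
  congr 1
  noncomm_ring

end Bond

/-! ## §2 The T³ member: the chart curve of the gauge copies through `A₀`, and the gauge velocity family -/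

section Member

variable {F : T3Family} {n K : ℕ}

/-- ★ **THE CHART CURVE THROUGH `A₀` AND ITS VELOCITY** (complex `t`): for `‖A₀(b)‖ < log 2` bondwise, `t ↦ (log(e^{tN(b₋)}·e^{A₀(b)}U₀(b)·e^{−tN(b₊)}·U₀(b)⁻¹))_b` has derivative
`V(A₀) = (Dlog(e^{A₀(b)})[N(b₋)e^{A₀(b)} − e^{A₀(b)}·U₀(b)N(b₊)U₀(b)⁻¹])_b` at `0`. [cite: Balaban1985Averaging, (8) p.19, (21) p.21, p.28] -/
theorem hasDerivAt_chartCurveAt (U₀ : GaugeField (F.P K) 0 (Matrix.specialUnitaryGroup (Fin 2) ℂ)) (N : Site (F.P K) 0 → Matrix (Fin 2) (Fin 2) ℂ)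
    {A₀ : PBond (F.P K) 0 → Matrix (Fin 2) (Fin 2) ℂ} (hA₀ : ∀ b, ‖A₀ b‖ < Real.log 2) :
    HasDerivAt (fun t : ℂ => fun b : PBond (F.P K) 0 =>
        mlog (exp (t • N b.src) * (exp (A₀ b) * ((bgUnits F K U₀ b : (Matrix (Fin 2) (Fin 2) ℂ)ˣ) : Matrix (Fin 2) (Fin 2) ℂ)) * exp (t • (-N b.tgt))
          * (((bgUnits F K U₀ b)⁻¹ : (Matrix (Fin 2) (Fin 2) ℂ)ˣ) : Matrix (Fin 2) (Fin 2) ℂ)))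
      (fun b : PBond (F.P K) 0 => fderiv ℂ (mlog : Matrix (Fin 2) (Fin 2) ℂ → Matrix (Fin 2) (Fin 2) ℂ) (exp (A₀ b))
        (N b.src * exp (A₀ b) - exp (A₀ b) * (((bgUnits F K U₀ b : (Matrix (Fin 2) (Fin 2) ℂ)ˣ) : Matrix (Fin 2) (Fin 2) ℂ) * N b.tgt
          * (((bgUnits F K U₀ b)⁻¹ : (Matrix (Fin 2) (Fin 2) ℂ)ˣ) : Matrix (Fin 2) (Fin 2) ℂ)))) 0 := by
  rw [hasDerivAt_pi]
  intro b
  exact hasDerivAt_mlog_conjCurveAt (N b.src) (N b.tgt) (bgUnits F K U₀ b) (hA₀ b)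

/-- ★ **THE SAME ALONG REAL `t`** (the parameter of ✓`fderiv_logChartTwS_gaugeVelocity_apply`). [cite: Balaban1985Averaging, (8) p.19, (21) p.21, p.28] -/
theorem hasDerivAt_chartCurveAt_real (U₀ : GaugeField (F.P K) 0 (Matrix.specialUnitaryGroup (Fin 2) ℂ)) (N : Site (F.P K) 0 → Matrix (Fin 2) (Fin 2) ℂ)
    {A₀ : PBond (F.P K) 0 → Matrix (Fin 2) (Fin 2) ℂ} (hA₀ : ∀ b, ‖A₀ b‖ < Real.log 2) :
    HasDerivAt (fun t : ℝ => fun b : PBond (F.P K) 0 =>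
        mlog (exp ((t : ℂ) • N b.src) * (exp (A₀ b) * ((bgUnits F K U₀ b : (Matrix (Fin 2) (Fin 2) ℂ)ˣ) : Matrix (Fin 2) (Fin 2) ℂ)) * exp ((t : ℂ) • (-N b.tgt))
          * (((bgUnits F K U₀ b)⁻¹ : (Matrix (Fin 2) (Fin 2) ℂ)ˣ) : Matrix (Fin 2) (Fin 2) ℂ)))
      (fun b : PBond (F.P K) 0 => fderiv ℂ (mlog : Matrix (Fin 2) (Fin 2) ℂ → Matrix (Fin 2) (Fin 2) ℂ) (exp (A₀ b))
        (N b.src * exp (A₀ b) - exp (A₀ b) * (((bgUnits F K U₀ b : (Matrix (Fin 2) (Fin 2) ℂ)ˣ) : Matrix (Fin 2) (Fin 2) ℂ) * N b.tgt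
          * (((bgUnits F K U₀ b)⁻¹ : (Matrix (Fin 2) (Fin 2) ℂ)ˣ) : Matrix (Fin 2) (Fin 2) ℂ)))) 0 := by
  have hofR : HasDerivAt (Complex.ofRealCLM : ℝ → ℂ) (Complex.ofRealCLM 1) 0 := Complex.ofRealCLM.hasDerivAt
  have hc := hasDerivAt_chartCurveAt U₀ N hA₀
  rw [show ((0 : ℂ)) = Complex.ofRealCLM (0 : ℝ) by rw [Complex.ofRealCLM_apply, Complex.ofReal_zero]] at hc
  have h2 := (hc.scomp (0 : ℝ) hofR).congr_deriv (by rw [Complex.ofRealCLM_apply, Complex.ofReal_one, one_smul])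
  simpa only [Function.comp_def, Complex.ofRealCLM_apply] using h2

/-- The chart curve starts at `A₀`. [cite: Balaban1985Averaging, (21) p.21] -/
theorem chartCurveAt_zero (U₀ : GaugeField (F.P K) 0 (Matrix.specialUnitaryGroup (Fin 2) ℂ)) (N : Site (F.P K) 0 → Matrix (Fin 2) (Fin 2) ℂ)
    {A₀ : PBond (F.P K) 0 → Matrix (Fin 2) (Fin 2) ℂ} (hA₀ : ∀ b, ‖A₀ b‖ < Real.log 2) :
    (fun b : PBond (F.P K) 0 =>
        mlog (exp ((0 : ℂ) • N b.src) * (exp (A₀ b) * ((bgUnits F K U₀ b : (Matrix (Fin 2) (Fin 2) ℂ)ˣ) : Matrix (Fin 2) (Fin 2) ℂ)) * exp ((0 : ℂ) • (-N b.tgt))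
          * (((bgUnits F K U₀ b)⁻¹ : (Matrix (Fin 2) (Fin 2) ℂ)ˣ) : Matrix (Fin 2) (Fin 2) ℂ))) = A₀ := by
  funext b
  exact mlog_conjCurveAt_zero (N b.src) (N b.tgt) (bgUnits F K U₀ b) (hA₀ b)

/-- ★ **THE `hcopy` LETTER AT `A₀`** (complex `t`): for `t` near `0`, `e^{A_t}·U₀♭ = (e^{A₀}U₀♭)^{g_t}`, `g_t(x) = e^{tN(x)}` (`exp ∘ log = id` on the window).
[cite: Balaban1985Averaging, (8) p.19, (11) p.19, p.28] -/
theorem expUnit_chartCurveAt_eventually (U₀ : GaugeField (F.P K) 0 (Matrix.specialUnitaryGroup (Fin 2) ℂ)) (N : Site (F.P K) 0 → Matrix (Fin 2) (Fin 2) ℂ)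
    {A₀ : PBond (F.P K) 0 → Matrix (Fin 2) (Fin 2) ℂ} (hA₀ : ∀ b, ‖A₀ b‖ < Real.log 2) :
    ∀ᶠ t : ℂ in 𝓝 0,
      (fun b : PBond (F.P K) 0 => expUnit (mlog (exp (t • N b.src) * (exp (A₀ b) * ((bgUnits F K U₀ b : (Matrix (Fin 2) (Fin 2) ℂ)ˣ) : Matrix (Fin 2) (Fin 2) ℂ))
          * exp (t • (-N b.tgt)) * (((bgUnits F K U₀ b)⁻¹ : (Matrix (Fin 2) (Fin 2) ℂ)ˣ) : Matrix (Fin 2) (Fin 2) ℂ))) * bgUnits F K U₀ b)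
        = gaugeActT (fun x => expUnit (t • N x)) (fun b => expUnit (A₀ b) * bgUnits F K U₀ b) := by
  have hall : ∀ᶠ t : ℂ in 𝓝 0, ∀ b : PBond (F.P K) 0,
      ‖exp (t • N b.src) * (exp (A₀ b) * ((bgUnits F K U₀ b : (Matrix (Fin 2) (Fin 2) ℂ)ˣ) : Matrix (Fin 2) (Fin 2) ℂ)) * exp (t • (-N b.tgt))
          * (((bgUnits F K U₀ b)⁻¹ : (Matrix (Fin 2) (Fin 2) ℂ)ˣ) : Matrix (Fin 2) (Fin 2) ℂ) - 1‖ < 1 :=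
    eventually_all.2 fun b => eventually_norm_conjCurveAt_sub_one_lt (N b.src) (N b.tgt) (bgUnits F K U₀ b) (hA₀ b)
  filter_upwards [hall] with t ht
  funext b
  apply Units.ext
  rw [Units.val_mul, val_expUnit, exp_mlog (ht b), gaugeActT_apply, Units.val_mul, Units.val_mul, Units.val_mul, val_inv_expUnit, val_expUnit, val_expUnit, val_expUnit,
    Units.inv_mul_cancel_right, smul_neg]

/-- ★ **THE `hcopy` LETTER AT `A₀`, REAL `t`.** [cite: Balaban1985Averaging, (8) p.19, (11) p.19, p.28] -/
theorem expUnit_chartCurveAt_eventually_real (U₀ : GaugeField (F.P K) 0 (Matrix.specialUnitaryGroup (Fin 2) ℂ)) (N : Site (F.P K) 0 → Matrix (Fin 2) (Fin 2) ℂ)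
    {A₀ : PBond (F.P K) 0 → Matrix (Fin 2) (Fin 2) ℂ} (hA₀ : ∀ b, ‖A₀ b‖ < Real.log 2) :
    ∀ᶠ t : ℝ in 𝓝 0,
      (fun b : PBond (F.P K) 0 => expUnit (mlog (exp ((t : ℂ) • N b.src) * (exp (A₀ b) * ((bgUnits F K U₀ b : (Matrix (Fin 2) (Fin 2) ℂ)ˣ) : Matrix (Fin 2) (Fin 2) ℂ))
          * exp ((t : ℂ) • (-N b.tgt)) * (((bgUnits F K U₀ b)⁻¹ : (Matrix (Fin 2) (Fin 2) ℂ)ˣ) : Matrix (Fin 2) (Fin 2) ℂ))) * bgUnits F K U₀ b)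
        = gaugeActT (fun x => expUnit ((t : ℂ) • N x)) (fun b => expUnit (A₀ b) * bgUnits F K U₀ b) := by
  have ht : Tendsto (fun t : ℝ => (t : ℂ)) (𝓝 0) (𝓝 0) := by
    have := Complex.continuous_ofReal.tendsto (0 : ℝ)
    rwa [Complex.ofReal_zero] at this
  exact ht.eventually (expUnit_chartCurveAt_eventually U₀ N hA₀)

/-- **`V(0) = D_{U₀}N`**: at the chart origin the velocity is the gauge direction at the background. [cite: Balaban1985BackgroundPropagators, (3.19) p.393] -/
theorem gaugeVelocityAt_zero (U₀ : GaugeField (F.P K) 0 (Matrix.specialUnitaryGroup (Fin 2) ℂ)) (N : Site (F.P K) 0 → Matrix (Fin 2) (Fin 2) ℂ) :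
    (fun b : PBond (F.P K) 0 => fderiv ℂ (mlog : Matrix (Fin 2) (Fin 2) ℂ → Matrix (Fin 2) (Fin 2) ℂ) (exp ((0 : PBond (F.P K) 0 → Matrix (Fin 2) (Fin 2) ℂ) b))
        (N b.src * exp ((0 : PBond (F.P K) 0 → Matrix (Fin 2) (Fin 2) ℂ) b) - exp ((0 : PBond (F.P K) 0 → Matrix (Fin 2) (Fin 2) ℂ) b)
          * (((bgUnits F K U₀ b : (Matrix (Fin 2) (Fin 2) ℂ)ˣ) : Matrix (Fin 2) (Fin 2) ℂ) * N b.tgt * (((bgUnits F K U₀ b)⁻¹ : (Matrix (Fin 2) (Fin 2) ℂ)ˣ) : Matrix (Fin 2) (Fin 2) ℂ))))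
      = fun b : PBond (F.P K) 0 =>
        N b.src - ((bgUnits F K U₀ b : (Matrix (Fin 2) (Fin 2) ℂ)ˣ) : Matrix (Fin 2) (Fin 2) ℂ) * N b.tgt * (((bgUnits F K U₀ b)⁻¹ : (Matrix (Fin 2) (Fin 2) ℂ)ˣ) : Matrix (Fin 2) (Fin 2) ℂ) := by
  funext b
  rw [Pi.zero_apply]
  exact velocityAt_zero (N b.src) (N b.tgt) (bgUnits F K U₀ b)

/-- ★★★ **`d∕ds|₀ V(sY) = ½[N + Ad_{U₀}N′, Y]` BONDWISE**: the velocity family along the chart ray `A₀ = sY` is differentiable at `s = 0` with derivative `2⁻¹•comm`,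
`comm b = (N(b₋) + U₀(b)N(b₊)U₀(b)⁻¹)·Y(b) − Y(b)·(N(b₋) + U₀(b)N(b₊)U₀(b)⁻¹)` — the commutator of ✓`Prop7AvgHessGaugeIdentityNormReading`'s `h2`.
[cite: Balaban1985Averaging, (21) p.21; Balaban1985BackgroundPropagators, (3.114)–(3.115) p.418] -/
theorem hasDerivAt_gaugeVelocityAt_smul (U₀ : GaugeField (F.P K) 0 (Matrix.specialUnitaryGroup (Fin 2) ℂ)) (N : Site (F.P K) 0 → Matrix (Fin 2) (Fin 2) ℂ)
    (Y : PBond (F.P K) 0 → Matrix (Fin 2) (Fin 2) ℂ) :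
    HasDerivAt (fun s : ℂ => fun b : PBond (F.P K) 0 => fderiv ℂ (mlog : Matrix (Fin 2) (Fin 2) ℂ → Matrix (Fin 2) (Fin 2) ℂ) (exp ((s • Y) b))
        (N b.src * exp ((s • Y) b) - exp ((s • Y) b)
          * (((bgUnits F K U₀ b : (Matrix (Fin 2) (Fin 2) ℂ)ˣ) : Matrix (Fin 2) (Fin 2) ℂ) * N b.tgt * (((bgUnits F K U₀ b)⁻¹ : (Matrix (Fin 2) (Fin 2) ℂ)ˣ) : Matrix (Fin 2) (Fin 2) ℂ))))
      (fun b : PBond (F.P K) 0 => (2 : ℂ)⁻¹ •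
        ((N b.src + ((bgUnits F K U₀ b : (Matrix (Fin 2) (Fin 2) ℂ)ˣ) : Matrix (Fin 2) (Fin 2) ℂ) * N b.tgt * (((bgUnits F K U₀ b)⁻¹ : (Matrix (Fin 2) (Fin 2) ℂ)ˣ) : Matrix (Fin 2) (Fin 2) ℂ)) * Y b
          - Y b * (N b.src + ((bgUnits F K U₀ b : (Matrix (Fin 2) (Fin 2) ℂ)ˣ) : Matrix (Fin 2) (Fin 2) ℂ) * N b.tgt * (((bgUnits F K U₀ b)⁻¹ : (Matrix (Fin 2) (Fin 2) ℂ)ˣ) : Matrix (Fin 2) (Fin 2) ℂ)))) 0 := by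
  rw [hasDerivAt_pi]
  intro b
  have h := hasDerivAt_velocityAt_smul (N b.src) (N b.tgt) (bgUnits F K U₀ b) (Y b)
  simpa only [Pi.smul_apply] using h

/-- The real gauge family `g_t(x) = e^{tN(x)}` is `1` at `t = 0`. [cite: Balaban1985Averaging, (8) p.19] -/
theorem gaugeFamily_zero (N : Site (F.P K) 0 → Matrix (Fin 2) (Fin 2) ℂ) :
    (fun x : Site (F.P K) 0 => expUnit (((0 : ℝ) : ℂ) • N x)) = fun _ => 1 := by
  funext x; apply Units.ext; rw [val_expUnit, Complex.ofReal_zero, zero_smul, exp_zero, Units.val_one]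

/-- The real gauge family has velocity `N` at `t = 0`. [cite: Balaban1985Averaging, (8) p.19] -/
theorem hasDerivAt_gaugeFamily (N : Site (F.P K) 0 → Matrix (Fin 2) (Fin 2) ℂ) (x : Site (F.P K) 0) :
    HasDerivAt (fun t : ℝ => ((expUnit ((t : ℂ) • N x) : (Matrix (Fin 2) (Fin 2) ℂ)ˣ) : Matrix (Fin 2) (Fin 2) ℂ)) (N x) 0 := by
  have h1 := hasDerivAt_exp_smul_const (𝕂 := ℝ) (N x) (0 : ℝ)
  simp only [zero_smul, exp_zero, one_mul] at h1
  have hfun : (fun t : ℝ => ((expUnit ((t : ℂ) • N x) : (Matrix (Fin 2) (Fin 2) ℂ)ˣ) : Matrix (Fin 2) (Fin 2) ℂ)) = fun t : ℝ => exp (t • N x) := by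
    funext t; rw [val_expUnit, Complex.coe_smul]
  rw [hfun]; exact h1

end Member

end Summit.QuantumFields.YangMills.Theorems.Prop7ChartGaugeCurveAt

end
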